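import Literature.IUT.HodgeArakelov.ThetaInftyDivisibility
import Literature.IUT.HodgeArakelov.EtaleThetaDataOfSettingCyclotomeTower

/-!
# [IUTchII] Prop 2.2 (ii) «respectively» clause AT THE MODEL — final corollary: no cohomological binder left

Proof-only companion (abc-iut cell, D-0067 wave 4, cone of [IUTchIII] Cor. 3.12; DAG node **IUTchII:Prop2.2(ii)**,
«respectively» (`∞θ^ι`) clause; no definitions, no `Prop`-valued facts; seat abc-iut-w4-d010 gen 2).
S. Mochizuki, *Inter-universal Teichmüller theory II*, kurims manuscript (Dec. 2020) §2, Prop. 2.2 (ii) p. 66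
l. 56–61 («determines a specific `μ`-orbit `∞θ^ι(Π_v) ⊆ ∞θ(Π_v)` … within each `{(l·ℤ) × μ}`-orbit contained in the set
`∞θ(Π_v)`»; claim key `Mochizuki2012`, DISPUTED, D-0012); [IUTchII] Prop. 1.4 p. 27; [EtTh] §1 pp. 12, 20.

abc-iut-w5-d187's `inftyClause_etaleThetaDataOfSetting'` (p414969) proved the clause at `D := etaleThetaDataOfSetting'`
modulo two binders: `hfix` (no nontrivial `Π_Ÿ ∩ K'`-fixed element of `l·Δ_Θ`) and `hdiv` (divisibility of the θ-classes
in the limit). abc-iut-w4-d041's `hfix_of_cyclotomeTower` (p419525) discharges `hfix` from `IsEtThOrigin` + a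
`CyclotomeTower` ([EtTh] §1 `Δ_Θ ≅ Ẑ(1)` data of abc-iut-L2-t8's `TowerOfSetting`); this seat's
`inftyClause_etaleThetaDataOfSetting'_of_thetaKummer` (p419496) discharges `hdiv` (in print's up-to-torsion form) from
Kummer theory of the roots of `Θ̈` on abc-iut-L2-t12's `ThetaKummerInput`. THIS FILE is the one-line meet:
`inftyClause_of_cyclotomeTower_thetaKummer` — the «respectively» clause at the model modulo
{`IsEtThOrigin`, `CyclotomeTower`, `E.etaDd = T.kummerTheta`, finite-level definability `hJ` of the roots of `Θ̈`}
and NOTHING cohomological. [claim: Mochizuki2012, status: disputed] Nothing here takes a side on [IUTchIII] Cor. 3.12;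
typed ≠ proved for the inputs.
-/

namespace Literature.IUT.HodgeArakelov

open Literature.AnabelianGeometry.EtaleTheta
open EtaleThetaDataOfSetting

noncomputable section

namespace EtaleThetaDataOfSetting

variable {p : ℕ} [Fact p.Prime] {D : Literature.AnabelianGeometry.EtaleTheta.ThetaSetting p}
  {E : D.EtaleThetaData} {l : ℕ} (C : E.DoubleUnderline l) [hN : (PiYdd C).Normal] [hYN : D.GtpYdd.Normal]
  {Es : Set ℕ+}

/-- **IUTchII:Prop2.2(ii) «respectively» clause IN FULL at the model `Π_v := Π^tp_X̲̲`, no cohomological binder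
left** (kurims p. 66 l. 56–61): `InftyClause` holds for every `IotaInvariantTheta'` datum over
`etaleThetaDataOfSetting'`, GIVEN the [EtTh] §1 guard `IsEtThOrigin`, a `CyclotomeTower` (abc-iut-w4-d041's
`hfix_of_cyclotomeTower`, p419525: «Δ_Θ ≅ Ẑ(1)» data ⇒ no nontrivial `Π_Ÿ ∩ K'`-fixed element of `l·Δ_Θ`), the Kummer
identification `E.etaDd = T.kummerTheta` and the finite-level definability `hJ` of the roots of `Θ̈` (this seat's
`inftyClause_etaleThetaDataOfSetting'_of_thetaKummer`, p419496: divisibility up to torsion of the θ-classes in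
`lim_J H¹(Π_Ÿ(Π_v)∣_J, (l·Δ_Θ)(Π_v))`). [claim: Mochizuki2012, status: disputed] (IUTchII §2 Prop 2.2 (ii), kurims p.66) -/
theorem inftyClause_of_cyclotomeTower_thetaKummer (hO : D.IsEtThOrigin) (τ : D.CyclotomeTower l Es)
    (hC : D.Compat) (hS : D.Sec2Hyps) (hchar : PiYddCharacteristic C) (S : BadPlaceSetting.{0})
    (eS : (Pi C) ≃ₜ* S.PiX) (hl : S.l = l) {T₀ : TemperedCoverings S (Pi C)}
    {Dec : SubgraphDecomposition S T₀ (etaleThetaDataOfSetting' C hC hS hchar S.toThetaSetting eS hl)}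
    (Θ : IotaInvariantTheta' Dec) (T : D.ThetaKummerInput) (hη : E.etaDd = T.kummerTheta)
    (hJ : ∀ M : ℕ+, ∃ J : Subgroup (Pi C), J.FiniteIndex ∧ IsOpen (J : Set (Pi C)) ∧
      ∀ g : Pi C, g ∈ PiYdd C ⊓ J → (g : D.PiTemp) • T.thetaRoots.root M = T.thetaRoots.root M) :
    Θ.InftyClause :=
  inftyClause_etaleThetaDataOfSetting'_of_thetaKummer C hC hS hchar S eS hl Θ (hfix_of_cyclotomeTower C hO τ)
    T hη hJ

end EtaleThetaDataOfSetting

end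

end Literature.IUT.HodgeArakelov
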